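import Summits.RiemannHypothesis.RiemannHypothesis.Theorems.WeilFormatCWindowPolarization
import Summits.RiemannHypothesis.RiemannHypothesis.Theorems.WeilFormatCWindowCoeffDecay
import HarnessLib

/-!
# Format C, design C∞ (L2 backbone): `C¹`-periodising smooth windows are admissible deflation profiles

Route context: Fourier–Galerkin / Schur-complement certificates of Weil positivity on a window ("format C";
cell memo `run/shared/lean/pub/rh-explicit/rh-explicit-weil-10/FORMATC-DESIGN.md` §9.12.11; supporting
stmt-RiemannHypothesis-0098; seat rh-explicit-weil-10).  Packaging of `WeilFormatCWindowPolarization` (sesquilinear dictionary for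
the summable class) with `WeilFormatCWindowCoeffDecay` (cubic coefficient decay from two matching boundary data): for windows
`𝟙_{[−a,a]}·f`, `𝟙_{[−a,a]}·g` with `f, g` thrice continuously differentiable and `f(−a) = f(a)`, `f′(−a) = f′(a)` (same for
`g`) — in particular the polynomial deflation profiles of design C∞ (even sector: even `p` with `p′(±a) = 0`; odd sector: odd
`p` with `p(±a) = 0`) and the basis windows `χ_n` — the entries of the deflated Gram matrix are limits of the finite Gram sums:
`weilWindowSesq a (proj a N (𝟙f)) (proj a N (𝟙g)) → weilWindowSesq a (𝟙f) (𝟙g)`.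

* `fourierCoeff_indicator` — the window coefficient ignores the cut-off;
* `isWindowFunction_indicator_of_hasDerivAt` — `𝟙_{[−a,a]}·f` is a window function for `f ∈ C¹`;
* `tendsto_weilWindowSesq_proj_indicator` — the limit statement above;
* `tendsto_weilWindowSesq_proj_indicator_of_contDiff` — the same with `ContDiff ℝ 3` and `deriv` boundary data.

Pure bookkeeping; standard axioms; no RH claim.
-/

set_option autoImplicit false
-- `Summit.RiemannHypothesis.RiemannHypothesis.…` is the layout-mandated namespace (summit = problem name).
set_option linter.dupNamespace false

noncomputable section

open Complex Filter Set MeasureTheory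
open scoped Real Topology

namespace Summit.RiemannHypothesis.RiemannHypothesis.Theorems.WeilFormatC

open Literature.NumberTheory.LFunctions
open Literature.NumberTheory.LFunctions.Yoshida1992 (proj)

variable {a : ℝ}

/-- The window Fourier coefficient of `𝟙_{[−a,a]}·f` is that of `f` (`a ≥ 0`). -/
theorem fourierCoeff_indicator (ha : 0 ≤ a) (n : ℤ) (f : ℝ → ℂ) :
    Yoshida1992.fourierCoeff a n ((Icc (-a) a).indicator f) = Yoshida1992.fourierCoeff a n f := by
  unfold Yoshida1992.fourierCoeff
  refine intervalIntegral.integral_congr fun x hx ↦ ?_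
  rw [uIcc_of_le (by linarith)] at hx
  simp only [indicator_of_mem hx]

/-- `𝟙_{[−a,a]}·f` is a window function when `f` has a continuous derivative. -/
theorem isWindowFunction_indicator_of_hasDerivAt (a : ℝ) {f f₁ : ℝ → ℂ} (h₀ : ∀ x, HasDerivAt f (f₁ x) x)
    (hc₁ : Continuous f₁) : IsWindowFunction a ((Icc (-a) a).indicator f) := by
  have hcf : Continuous f := continuous_iff_continuousAt.2 fun x ↦ (h₀ x).continuousAt
  obtain ⟨M, hM⟩ := (isCompact_Icc (a := -a) (b := a)).exists_bound_of_continuousOn hcf.continuousOn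
  obtain ⟨L, hL⟩ := (isCompact_Icc (a := -a) (b := a)).exists_bound_of_continuousOn hc₁.continuousOn
  refine ⟨hcf.measurable.indicator measurableSet_Icc, fun x hx ↦ indicator_of_notMem hx _,
    ⟨max M 0, fun x ↦ ?_⟩, ⟨L, fun x y hx hy ↦ ?_⟩⟩
  · by_cases hx : x ∈ Icc (-a) a
    · rw [indicator_of_mem hx]
      exact (hM x hx).trans (le_max_left _ _)
    · rw [indicator_of_notMem hx, norm_zero]
      exact le_max_right _ _
  · rw [indicator_of_mem hx, indicator_of_mem hy, ← Real.norm_eq_abs]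
    exact (convex_Icc (-a) a).norm_image_sub_le_of_norm_hasDerivWithin_le
      (fun z _ ↦ (h₀ z).hasDerivWithinAt) (fun z hz ↦ hL z hz) hx hy

/-- **`C¹`-periodising smooth windows are admissible profiles.**  Let `a > 0` and `f, g : ℝ → ℂ` have three
continuous derivatives with `f(−a) = f(a)`, `f′(−a) = f′(a)`, `g(−a) = g(a)`, `g′(−a) = g′(a)`.  Then
`weilWindowSesq a (proj a N (𝟙f)) (proj a N (𝟙g)) → weilWindowSesq a (𝟙f) (𝟙g)` (`𝟙 = 𝟙_{[−a,a]}`). -/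
theorem tendsto_weilWindowSesq_proj_indicator (ha : 0 < a) {f f₁ f₂ f₃ g g₁ g₂ g₃ : ℝ → ℂ}
    (hf₀ : ∀ x, HasDerivAt f (f₁ x) x) (hf₁ : ∀ x, HasDerivAt f₁ (f₂ x) x) (hf₂ : ∀ x, HasDerivAt f₂ (f₃ x) x)
    (hf₃ : Continuous f₃) (hfe₀ : f (-a) = f a) (hfe₁ : f₁ (-a) = f₁ a)
    (hg₀ : ∀ x, HasDerivAt g (g₁ x) x) (hg₁ : ∀ x, HasDerivAt g₁ (g₂ x) x) (hg₂ : ∀ x, HasDerivAt g₂ (g₃ x) x)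
    (hg₃ : Continuous g₃) (hge₀ : g (-a) = g a) (hge₁ : g₁ (-a) = g₁ a) :
    Tendsto (fun N ↦ weilWindowSesq a (proj a N ((Icc (-a) a).indicator f)) (proj a N ((Icc (-a) a).indicator g)))
      atTop (𝓝 (weilWindowSesq a ((Icc (-a) a).indicator f) ((Icc (-a) a).indicator g))) := by
  have hcf : Continuous f := continuous_iff_continuousAt.2 fun x ↦ (hf₀ x).continuousAt
  have hcg : Continuous g := continuous_iff_continuousAt.2 fun x ↦ (hg₀ x).continuousAt
  have hc₁f : Continuous f₁ := continuous_iff_continuousAt.2 fun x ↦ (hf₁ x).continuousAt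
  have hc₁g : Continuous g₁ := continuous_iff_continuousAt.2 fun x ↦ (hg₁ x).continuousAt
  have hma : -a ∈ Icc (-a) a := left_mem_Icc.2 (by linarith)
  have hpa : a ∈ Icc (-a) a := right_mem_Icc.2 (by linarith)
  obtain ⟨hsf0, hsf1⟩ := summable_norm_fourierCoeff_of_C1_periodising ha hf₀ hf₁ hf₂ hf₃ hfe₀ hfe₁
  obtain ⟨hsg0, hsg1⟩ := summable_norm_fourierCoeff_of_C1_periodising ha hg₀ hg₁ hg₂ hg₃ hge₀ hge₁
  refine tendsto_weilWindowSesq_proj_of_summable ha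
    (isWindowFunction_indicator_of_hasDerivAt a hf₀ hc₁f) (isWindowFunction_indicator_of_hasDerivAt a hg₀ hc₁g)
    (hcf.continuousOn.congr fun x hx ↦ indicator_of_mem hx f) (hcg.continuousOn.congr fun x hx ↦ indicator_of_mem hx g)
    ?_ ?_ ?_ ?_ ?_ ?_
  · rw [indicator_of_mem hma, indicator_of_mem hpa, hfe₀]
  · rw [indicator_of_mem hma, indicator_of_mem hpa, hge₀]
  · simpa only [fourierCoeff_indicator ha.le] using hsf0
  · simpa only [fourierCoeff_indicator ha.le] using hsf1
  · simpa only [fourierCoeff_indicator ha.le] using hsg0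
  · simpa only [fourierCoeff_indicator ha.le] using hsg1


/-! ## The same in `ContDiff`/`deriv` language -/

/-- The derivative chain of a `C³` function (real variable, complex values): `f^{(k)}` has derivative `f^{(k+1)}` for `k ≤ 2`,
and `f‴` is continuous. -/
theorem hasDerivAt_iteratedDeriv_of_contDiff_three {f : ℝ → ℂ} (hf : ContDiff ℝ 3 f) :
    (∀ x, HasDerivAt f (iteratedDeriv 1 f x) x) ∧ (∀ x, HasDerivAt (iteratedDeriv 1 f) (iteratedDeriv 2 f x) x)
      ∧ (∀ x, HasDerivAt (iteratedDeriv 2 f) (iteratedDeriv 3 f x) x) ∧ Continuous (iteratedDeriv 3 f) := by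
  have d0 : Differentiable ℝ (iteratedDeriv 0 f) := hf.differentiable_iteratedDeriv 0 (by norm_num)
  have d1 : Differentiable ℝ (iteratedDeriv 1 f) := hf.differentiable_iteratedDeriv 1 (by norm_num)
  have d2 : Differentiable ℝ (iteratedDeriv 2 f) := hf.differentiable_iteratedDeriv 2 (by norm_num)
  refine ⟨fun x ↦ ?_, fun x ↦ ?_, fun x ↦ ?_, hf.continuous_iteratedDeriv 3 le_rfl⟩
  · have h := (d0 x).hasDerivAt
    rw [iteratedDeriv_zero] at h
    rwa [iteratedDeriv_succ, iteratedDeriv_zero]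
  · have h := (d1 x).hasDerivAt
    rwa [show iteratedDeriv 2 f = deriv (iteratedDeriv 1 f) from iteratedDeriv_succ]
  · have h := (d2 x).hasDerivAt
    rwa [show iteratedDeriv 3 f = deriv (iteratedDeriv 2 f) from iteratedDeriv_succ]

/-- **Admissible profiles, `ContDiff` form.**  `f, g ∈ C³(ℝ)` with `f(−a) = f(a)`, `f′(−a) = f′(a)`, `g(−a) = g(a)`,
`g′(−a) = g′(a)` (`a > 0`): `weilWindowSesq a (proj a N (𝟙f)) (proj a N (𝟙g)) → weilWindowSesq a (𝟙f) (𝟙g)`.  The polynomial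
profiles of design C∞ (even `p` with `p′(a) = 0`; odd `p` with `p(a) = 0`) and the basis cores `chiCore a m` qualify. -/
theorem tendsto_weilWindowSesq_proj_indicator_of_contDiff (ha : 0 < a) {f g : ℝ → ℂ}
    (hf : ContDiff ℝ 3 f) (hg : ContDiff ℝ 3 g) (hfe₀ : f (-a) = f a) (hfe₁ : deriv f (-a) = deriv f a)
    (hge₀ : g (-a) = g a) (hge₁ : deriv g (-a) = deriv g a) :
    Tendsto (fun N ↦ weilWindowSesq a (proj a N ((Icc (-a) a).indicator f)) (proj a N ((Icc (-a) a).indicator g)))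
      atTop (𝓝 (weilWindowSesq a ((Icc (-a) a).indicator f) ((Icc (-a) a).indicator g))) := by
  obtain ⟨hf₀, hf₁, hf₂, hf₃⟩ := hasDerivAt_iteratedDeriv_of_contDiff_three hf
  obtain ⟨hg₀, hg₁, hg₂, hg₃⟩ := hasDerivAt_iteratedDeriv_of_contDiff_three hg
  rw [← iteratedDeriv_one] at hfe₁ hge₁
  exact tendsto_weilWindowSesq_proj_indicator ha hf₀ hf₁ hf₂ hf₃ hfe₀ hfe₁ hg₀ hg₁ hg₂ hg₃ hge₀ hge₁

end Summit.RiemannHypothesis.RiemannHypothesis.Theorems.WeilFormatC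

end
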